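import Summits.BirchSwinnertonDyer.BirchSwinnertonDyer.Theorems.SignedLowerHalvesSmallImageLowerHalfBothSignsRttKanBridges
import Summits.BirchSwinnertonDyer.BirchSwinnertonDyer.Theorems.PrintX11aUpperNonSurjFiveExcToolkit
import HarnessLib

/-!
# Route `SignedLowerHalves`, crux L `SmallImageLowerHalfBothSigns` (item stmt-BirchSwinnertonDyer-23599), line `rtt_w3`,
# stub Kan₂ `stub_thetaLayerLambda_ns` — brick K9a: the COMMON LEVEL of the two depleted forms and their Vatsal hypotheses

Width seat `bsd-line-slh-p3-w3` g11 under LEAD `cruxlead-stmt-BirchSwinnertonDyer-23599` g0 (cell `bsd-ssimc`). ROUTE-INDEPENDENT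
helper (`--supports stmt-BirchSwinnertonDyer-23599`); THEOREMS ONLY — no definition, no named fact, no `sorry`; closes nothing;
BSD is not proved by any of this.

The Kan₂ stub compares the `S₀`-depleted layer polynomials of the curve's newform `f` (level `N_W`) and of the CM partner `g`
(level `M`, `p ∤ M`, `max(2, v_ℓ M) = max(2, v_ℓ N_W)` at `ℓ ≠ p`, all primes of `N_W` and `M` in `S₀`). Brick K7
(`exists_depletedForm`) realises both depletions as normalised eigenforms at the EXACT levels `N_W · ∏_{v∈S₀} ℓ_v^{2−min(2,v_ℓ N_W)}`
and `M · ∏_{v∈S₀} ℓ_v^{2−min(2,v_ℓ M)}`; here: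

* §1 `padicValNat_prod_pow`, ★ `level_eq` — both levels equal `∏_{v∈S₀} ℓ_v^{max(2, v_ℓ ·)}`, hence EACH OTHER (prime-by-prime
  valuation count), so the two depleted forms live on the SAME `Γ₀(L)` as Vatsal's theorem wants; `not_dvd_level`, `le_level`,
  `dvd_level` (`p ∤ L`, `N ≤ L`, `ℓ_v ∣ L`).
* §2 `level_eq_of_places` — the instantiation to `(N_W, M, S₀)` under the stub's hypotheses (`ℓ ∣ N_W ⟺` bad reduction,
  `WeierstrassCurve.dvd_conductorNorm_iff`).
* §3 bookkeeping for a depleted form `G` (`a_n(G) = 𝟙[no ℓ_v ∣ n] a_n(g)`): integrality `valuation_cuspCoeff_depleted_le_one`,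
  `finiteDimensional_coeffField_depleted`, the PRIME congruence of two depleted forms from the congruence of their parents off `S₀`
  (`valuation_cuspCoeff_depleted_sub_lt_one_of_prime`), and the curve clause `valuation_cuspCoeff_depleted_sub_LFunction`.

References: [Vatsal1999] §1 (1.1)–(1.2), Thm. (1.6)/(1.13); [GreenbergVatsal2000] §1 p. 9; [DiamondShurman2005] §8.3, Prop. 5.8.5.
-/

set_option autoImplicit false
-- D-0017: single-problem summit, the namespace repeats the problem name by design.
set_option linter.dupNamespace false

noncomputable section

open scoped MatrixGroups ModularForm Classical NNReal

open CongruenceSubgroup Literature.NumberTheory.EllipticCurves Literature.NumberTheory.EllipticCurves.ModularForms Polynomial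
  IsDedekindDomain NumberField Rat.HeightOneSpectrum

namespace Summit.BirchSwinnertonDyer.BirchSwinnertonDyer.Theorems.SmallImageRttKan

open Summit.BirchSwinnertonDyer.BirchSwinnertonDyer.Theorems.GL1Cartan.Exc (valuation_le_one_iff valuation_lt_one_iff)

/-! ### §1 Level arithmetic -/

section Level

variable {ι : Type*}

/-- `v_q(∏_{v∈S} ℓ_v^{e_v}) = ∑_{v∈S} 𝟙[ℓ_v = q] e_v` for primes `ℓ_v`, `q`. [folklore] -/
theorem padicValNat_prod_pow (S : Finset ι) (ℓ e : ι → ℕ) (hprime : ∀ v ∈ S, (ℓ v).Prime) {q : ℕ} (hq : q.Prime) :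
    padicValNat q (∏ v ∈ S, ℓ v ^ e v) = ∑ v ∈ S, if ℓ v = q then e v else 0 := by
  classical
  haveI : Fact q.Prime := ⟨hq⟩
  induction S using Finset.induction_on with
  | empty => simp
  | insert a S ha ih =>
    have ha' : (ℓ a).Prime := hprime a (Finset.mem_insert_self a S)
    have hS' : ∀ v ∈ S, (ℓ v).Prime := fun v hv ↦ hprime v (Finset.mem_insert_of_mem hv)
    rw [Finset.prod_insert ha, Finset.sum_insert ha,
      padicValNat.mul (pow_ne_zero _ ha'.ne_zero)
        (Finset.prod_ne_zero_iff.mpr fun v hv ↦ pow_ne_zero _ (hS' v hv).ne_zero),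
      ih hS', padicValNat.pow]
    congr 1
    split_ifs with h
    · rw [h, padicValNat_self, mul_one]
    · haveI : Fact (ℓ a).Prime := ⟨ha'⟩
      rw [padicValNat_primes (Ne.symm h), mul_zero]

/-- ★ **The two exact depletion levels agree.** For an injective family of primes `(ℓ_v)_{v∈S}` and `A, B ≠ 0` all of whose
prime factors are among the `ℓ_v`, with `max(2, v_{ℓ_v} A) = max(2, v_{ℓ_v} B)` on `S`:
`A · ∏_{v∈S} ℓ_v^{2 − min(2, v_{ℓ_v} A)} = B · ∏_{v∈S} ℓ_v^{2 − min(2, v_{ℓ_v} B)}` (both are `∏_{v∈S} ℓ_v^{max(2, v_{ℓ_v} ·)}`).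
[cite: Vatsal1999, §1 (1.1) (the common level `N` of `f` and `g`)] -/
theorem level_eq (S : Finset ι) (ℓ : ι → ℕ) (hinj : Set.InjOn ℓ S) (hprime : ∀ v ∈ S, (ℓ v).Prime) {A B : ℕ}
    (hA : A ≠ 0) (hB : B ≠ 0) (hAS : ∀ q : ℕ, q.Prime → q ∣ A → ∃ v ∈ S, ℓ v = q)
    (hBS : ∀ q : ℕ, q.Prime → q ∣ B → ∃ v ∈ S, ℓ v = q)
    (hmax : ∀ v ∈ S, max 2 (padicValNat (ℓ v) A) = max 2 (padicValNat (ℓ v) B)) :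
    A * ∏ v ∈ S, ℓ v ^ (2 - min 2 (padicValNat (ℓ v) A)) = B * ∏ v ∈ S, ℓ v ^ (2 - min 2 (padicValNat (ℓ v) B)) := by
  classical
  have hPA : ∏ v ∈ S, ℓ v ^ (2 - min 2 (padicValNat (ℓ v) A)) ≠ 0 :=
    Finset.prod_ne_zero_iff.mpr fun v hv ↦ pow_ne_zero _ (hprime v hv).ne_zero
  have hPB : ∏ v ∈ S, ℓ v ^ (2 - min 2 (padicValNat (ℓ v) B)) ≠ 0 :=
    Finset.prod_ne_zero_iff.mpr fun v hv ↦ pow_ne_zero _ (hprime v hv).ne_zero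
  refine (Nat.eq_iff_prime_padicValNat_eq _ _ (mul_ne_zero hA hPA) (mul_ne_zero hB hPB)).mpr fun q hq ↦ ?_
  haveI : Fact q.Prime := ⟨hq⟩
  rw [padicValNat.mul hA hPA, padicValNat.mul hB hPB, padicValNat_prod_pow S ℓ _ hprime hq,
    padicValNat_prod_pow S ℓ _ hprime hq]
  by_cases hqS : ∃ v ∈ S, ℓ v = q
  · obtain ⟨v, hv, rfl⟩ := hqS
    have hsum : ∀ e : ι → ℕ, (∑ w ∈ S, if ℓ w = ℓ v then e w else 0) = e v := fun e ↦ by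
      rw [Finset.sum_eq_single_of_mem v hv fun w hw hne ↦ if_neg fun h ↦ hne (hinj hw hv h), if_pos rfl]
    rw [hsum, hsum]
    have h := hmax v hv
    rcases le_total 2 (padicValNat (ℓ v) A) with h2A | h2A <;>
      rcases le_total 2 (padicValNat (ℓ v) B) with h2B | h2B <;>
      simp only [max_eq_right h2A, max_eq_left h2A, min_eq_left h2A, min_eq_right h2A, max_eq_right h2B,
        max_eq_left h2B, min_eq_left h2B, min_eq_right h2B] at h ⊢ <;> omega
  · push Not at hqS
    have hA0 : padicValNat q A = 0 :=
      padicValNat.eq_zero_of_not_dvd fun h ↦ by obtain ⟨v, hv, h'⟩ := hAS q hq h; exact hqS v hv h'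
    have hB0 : padicValNat q B = 0 :=
      padicValNat.eq_zero_of_not_dvd fun h ↦ by obtain ⟨v, hv, h'⟩ := hBS q hq h; exact hqS v hv h'
    rw [hA0, hB0, Finset.sum_eq_zero fun w hw ↦ if_neg (hqS w hw), Finset.sum_eq_zero fun w hw ↦ if_neg (hqS w hw)]

/-- A prime outside the family and not dividing `A` does not divide the depletion level `A · ∏ ℓ_v^{e_v}`. [folklore] -/
theorem not_dvd_level (S : Finset ι) (ℓ e : ι → ℕ) (hprime : ∀ v ∈ S, (ℓ v).Prime) {A p : ℕ} (hp : p.Prime)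
    (hpA : ¬ p ∣ A) (hS : ∀ v ∈ S, ℓ v ≠ p) : ¬ p ∣ A * ∏ v ∈ S, ℓ v ^ e v := by
  intro h
  rcases (Nat.Prime.dvd_mul hp).mp h with h | h
  · exact hpA h
  · obtain ⟨v, hv, hdvd⟩ := (Prime.dvd_finsetProd_iff hp.prime _).mp h
    exact hS v hv ((Nat.prime_dvd_prime_iff_eq hp (hprime v hv)).mp (hp.dvd_of_dvd_pow hdvd)).symm

/-- The depletion level is at least the original level: `A ≤ A · ∏ ℓ_v^{e_v}`. [folklore] -/
theorem le_level (S : Finset ι) (ℓ e : ι → ℕ) (hprime : ∀ v ∈ S, (ℓ v).Prime) (A : ℕ) :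
    A ≤ A * ∏ v ∈ S, ℓ v ^ e v :=
  Nat.le_mul_of_pos_right A (Finset.prod_pos fun v hv ↦ pow_pos (hprime v hv).pos _)

/-- Every `ℓ_v`, `v ∈ S`, divides the exact depletion level `A · ∏_{w∈S} ℓ_w^{2 − min(2, v_{ℓ_w} A)}` (`A ≠ 0`): either
`ℓ_v ∣ A`, or its exponent in the product is `2`. [folklore] -/
theorem dvd_level (S : Finset ι) (ℓ : ι → ℕ) (A : ℕ) {v : ι} (hv : v ∈ S) :
    ℓ v ∣ A * ∏ w ∈ S, ℓ w ^ (2 - min 2 (padicValNat (ℓ w) A)) := by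
  classical
  by_cases h : ℓ v ∣ A
  · exact dvd_mul_of_dvd_left h _
  · refine dvd_mul_of_dvd_right ((dvd_pow_self (ℓ v) ?_).trans
      (Finset.dvd_prod_of_mem (fun w ↦ ℓ w ^ (2 - min 2 (padicValNat (ℓ w) A))) hv)) _
    rw [padicValNat.eq_zero_of_not_dvd h]
    norm_num

end Level

/-! ### §2 The instantiation to the curve, the partner and the places `S₀` -/

section Places

variable (W : WeierstrassCurve ℚ) [W.IsElliptic]

/-- ★ **The curve's and the partner's exact depletion levels coincide** under the Kan₂ stub's level hypotheses: `S₀` avoids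
`p` and contains every bad place of `W` and every place dividing `M`, and `max(2, v_ℓ M) = max(2, v_ℓ N_W)` for `ℓ ≠ p`.
[cite: Vatsal1999, §1 (1.1)] [cite: DiamondShurman2005, §8.3 (PDF p. 353)] -/
theorem level_eq_of_places {p : ℕ} [Fact p.Prime] {M : ℕ} [NeZero M] [NeZero (W.conductorNorm ℤ)]
    (S₀ : Finset (HeightOneSpectrum (𝓞 ℚ))) (hS : ∀ v ∈ S₀, natGenerator v ≠ p)
    (hbad : ∀ v : HeightOneSpectrum (𝓞 ℚ), ¬ W.HasGoodReductionAt v → v ∈ S₀)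
    (hM : ∀ v : HeightOneSpectrum (𝓞 ℚ), natGenerator v ∣ M → v ∈ S₀)
    (hlev : ∀ ℓ : ℕ, ℓ.Prime → ℓ ≠ p → max 2 (padicValNat ℓ M) = max 2 (padicValNat ℓ (W.conductorNorm ℤ))) :
    W.conductorNorm ℤ * ∏ v ∈ S₀, natGenerator v ^ (2 - min 2 (padicValNat (natGenerator v) (W.conductorNorm ℤ))) =
      M * ∏ v ∈ S₀, natGenerator v ^ (2 - min 2 (padicValNat (natGenerator v) M)) := by
  refine level_eq S₀ (fun v ↦ natGenerator v)
    (fun v _ w _ h ↦ (primesEquiv (R := 𝓞 ℚ)).injective (Subtype.ext h)) (fun v _ ↦ prime_natGenerator v)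
    (NeZero.ne _) (NeZero.ne _) (fun q hq hqN ↦ ?_) (fun q hq hqM ↦ ?_)
    fun v hv ↦ (hlev _ (prime_natGenerator v) (hS v hv)).symm
  · -- the place under `q` (tree: `Rat.exists_natGenerator_eq`, inlined to keep the imports light)
    obtain ⟨v, hv⟩ : ∃ v : HeightOneSpectrum (𝓞 ℚ), natGenerator v = q :=
      ⟨(primesEquiv (R := 𝓞 ℚ)).symm ⟨q, hq⟩, congrArg Subtype.val ((primesEquiv (R := 𝓞 ℚ)).apply_symm_apply ⟨q, hq⟩)⟩
    refine ⟨v, hbad v ((W.dvd_conductorNorm_iff v).mp ?_), hv⟩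
    show natGenerator v ∣ W.conductorNorm ℤ
    rwa [hv]
  · obtain ⟨v, hv⟩ : ∃ v : HeightOneSpectrum (𝓞 ℚ), natGenerator v = q :=
      ⟨(primesEquiv (R := 𝓞 ℚ)).symm ⟨q, hq⟩, congrArg Subtype.val ((primesEquiv (R := 𝓞 ℚ)).apply_symm_apply ⟨q, hq⟩)⟩
    exact ⟨v, hM v (hv ▸ hqM), hv⟩

end Places

/-! ### §3 Bookkeeping for depleted forms -/

section Depleted

variable {p : ℕ} [Fact p.Prime] {L M N : ℕ} (S₀ : Finset (HeightOneSpectrum (𝓞 ℚ))) (e : PadicAlgCl p ≃+* ℂ)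

/-- A depleted form's coefficients are `0` or the parent's. [folklore] -/
theorem cuspCoeff_depleted_eq_zero_or {G : CuspForm (Gamma0 L) 2} {g : CuspForm (Gamma0 M) 2}
    (hq : ∀ n : ℕ, cuspCoeff G n = if ∃ v ∈ S₀, natGenerator v ∣ n then 0 else cuspCoeff g n) (n : ℕ) :
    cuspCoeff G n = 0 ∨ cuspCoeff G n = cuspCoeff g n := by
  rw [hq n]
  split_ifs
  · exact Or.inl rfl
  · exact Or.inr rfl

/-- A depleted form of a `p`-integral form is `p`-integral. [cite: Vatsal1999, §1 (1.1) («coefficients in 𝒪»)] -/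
theorem valuation_cuspCoeff_depleted_le_one {G : CuspForm (Gamma0 L) 2} {g : CuspForm (Gamma0 M) 2}
    (hq : ∀ n : ℕ, cuspCoeff G n = if ∃ v ∈ S₀, natGenerator v ∣ n then 0 else cuspCoeff g n)
    (hg : ∀ n : ℕ, Valued.v (e.symm (cuspCoeff g n)) ≤ 1) (n : ℕ) : Valued.v (e.symm (cuspCoeff G n)) ≤ 1 := by
  rcases cuspCoeff_depleted_eq_zero_or S₀ hq n with h | h
  · rw [h, map_zero, Valuation.map_zero]; exact zero_le_one
  · rw [h]; exact hg n

/-- A depleted form of a form with number-field coefficients has number-field coefficients. [cite: Shimura1971, Thm. 3.48] -/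
theorem finiteDimensional_coeffField_depleted {G : CuspForm (Gamma0 L) 2} {g : CuspForm (Gamma0 M) 2}
    (hq : ∀ n : ℕ, cuspCoeff G n = if ∃ v ∈ S₀, natGenerator v ∣ n then 0 else cuspCoeff g n)
    (hfd : FiniteDimensional ℚ (coeffField g)) : FiniteDimensional ℚ (coeffField G) :=
  finiteDimensional_coeffField_of_cuspCoeff hfd (cuspCoeff_depleted_eq_zero_or S₀ hq)

/-- For a prime `q`, `ℓ_v ∣ q ⟺ ℓ_v = q`. [folklore] -/
theorem natGenerator_dvd_prime_iff (v : HeightOneSpectrum (𝓞 ℚ)) {q : ℕ} (hq : q.Prime) :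
    natGenerator v ∣ q ↔ natGenerator v = q :=
  Nat.prime_dvd_prime_iff_eq (prime_natGenerator v) hq

/-- **The prime congruence of two depleted forms** `G_f, G_g` (same places `S₀`): at a prime `q = ℓ_v` both coefficients
vanish; at any other prime it is the congruence `a_q(f) ≡ a_q(g)` of the parents, assumed off `S₀`.
[cite: Vatsal1999, §1 (1.1) («aₙ ≡ bₙ (mod π)»)] -/
theorem valuation_cuspCoeff_depleted_sub_lt_one_of_prime {Gf Gg : CuspForm (Gamma0 L) 2} {f : CuspForm (Gamma0 N) 2}
    {g : CuspForm (Gamma0 M) 2} (hqf : ∀ n : ℕ, cuspCoeff Gf n = if ∃ v ∈ S₀, natGenerator v ∣ n then 0 else cuspCoeff f n)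
    (hqg : ∀ n : ℕ, cuspCoeff Gg n = if ∃ v ∈ S₀, natGenerator v ∣ n then 0 else cuspCoeff g n)
    (hfg : ∀ q : ℕ, q.Prime → (∀ v ∈ S₀, natGenerator v ≠ q) → Valued.v (e.symm (cuspCoeff f q - cuspCoeff g q)) < 1)
    {q : ℕ} (hq : q.Prime) : Valued.v (e.symm (cuspCoeff Gf q - cuspCoeff Gg q)) < 1 := by
  rw [hqf q, hqg q]
  by_cases h : ∃ v ∈ S₀, natGenerator v ∣ q
  · rw [if_pos h, if_pos h, sub_zero, map_zero, Valuation.map_zero]; exact zero_lt_one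
  · rw [if_neg h, if_neg h]
    push Not at h
    exact hfg q hq fun v hv heq ↦ h v hv (heq ▸ dvd_rfl)

/-- **The curve clause for the depleted newform of `W`**: at primes `ℓ ∤ L·p` (so `ℓ ≠ ℓ_v`, as every `ℓ_v ∣ L`),
`a_ℓ(G_f) = a_ℓ(f) = a_ℓ(W)`. [cite: Vatsal1999, Thm. (1.13) (the elliptic curve `E` with `ρ_𝔪 ≅ E[p]`)] -/
theorem valuation_cuspCoeff_depleted_sub_LFunction [NeZero N] (W : WeierstrassCurve ℚ) {Gf : CuspForm (Gamma0 L) 2}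
    {f : CuspForm (Gamma0 N) 2} (hf : IsNewformOf W f)
    (hqf : ∀ n : ℕ, cuspCoeff Gf n = if ∃ v ∈ S₀, natGenerator v ∣ n then 0 else cuspCoeff f n)
    (hL : ∀ v ∈ S₀, natGenerator v ∣ L) {ℓ : ℕ} (hℓ : ℓ.Prime) (hℓL : ¬ ℓ ∣ L * p) :
    Valued.v (e.symm (cuspCoeff Gf ℓ - (W.LFunction ℓ : ℂ))) < 1 := by
  have h : ¬ ∃ v ∈ S₀, natGenerator v ∣ ℓ := by
    rintro ⟨v, hv, hdvd⟩
    rw [natGenerator_dvd_prime_iff v hℓ] at hdvd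
    exact hℓL (dvd_mul_of_dvd_left (hdvd ▸ hL v hv) _)
  rw [hqf ℓ, if_neg h, hf.2 ℓ, sub_self, map_zero, Valuation.map_zero]
  exact zero_lt_one

/-- **The ALL-`n` congruence of the two depleted forms** on the common `Γ₀(L)` (Vatsal's hypothesis «aₙ ≡ bₙ (mod π)» for every
`n`), from the prime congruence of the parents off `S₀`, via the Hecke recursion at one level
(`GL1Cartan.Exc.valuation_cuspCoeff_sub_lt_one_of_prime`). [cite: DiamondShurman2005, Prop. 5.8.5] [cite: Vatsal1999, §1 (1.1)] -/
theorem valuation_cuspCoeff_depleted_sub_lt_one [NeZero L] {Gf Gg : CuspForm (Gamma0 L) 2} {f : CuspForm (Gamma0 N) 2}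
    {g : CuspForm (Gamma0 M) 2} (ef : IsHeckeEigenform Gf) (eg : IsHeckeEigenform Gg) (nf : IsNormalized Gf)
    (ng : IsNormalized Gg) (hif : ∀ n : ℕ, Valued.v (e.symm (cuspCoeff f n)) ≤ 1)
    (hig : ∀ n : ℕ, Valued.v (e.symm (cuspCoeff g n)) ≤ 1)
    (hqf : ∀ n : ℕ, cuspCoeff Gf n = if ∃ v ∈ S₀, natGenerator v ∣ n then 0 else cuspCoeff f n)
    (hqg : ∀ n : ℕ, cuspCoeff Gg n = if ∃ v ∈ S₀, natGenerator v ∣ n then 0 else cuspCoeff g n)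
    (hfg : ∀ q : ℕ, q.Prime → (∀ v ∈ S₀, natGenerator v ≠ q) → Valued.v (e.symm (cuspCoeff f q - cuspCoeff g q)) < 1)
    (n : ℕ) : Valued.v (e.symm (cuspCoeff Gf n - cuspCoeff Gg n)) < 1 :=
  GL1Cartan.Exc.valuation_cuspCoeff_sub_lt_one_of_prime e ef eg nf ng
    (valuation_cuspCoeff_depleted_le_one S₀ e hqf hif) (valuation_cuspCoeff_depleted_le_one S₀ e hqg hig)
    (fun _ hq ↦ valuation_cuspCoeff_depleted_sub_lt_one_of_prime S₀ e hqf hqg hfg hq) n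

end Depleted

end Summit.BirchSwinnertonDyer.BirchSwinnertonDyer.Theorems.SmallImageRttKan

end
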